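import Summits.HubbardSuperconductivity.HubbardLadder.Bounds.TwistInsensitivityCluster
import Summits.HubbardSuperconductivity.HubbardLadder.Bounds.TwistedCouplingDegree
import Mathlib.Analysis.Complex.ExponentialBounds
import HarnessLib

/-!
# Twist insensitivity of the grand-canonical `t–t'` Hubbard torus for `T ≥ 610(|t|+|t'|)`:
# bounds.tex Theorem 12 (i)–(ii) with the CATALAN tree-graph entropy bound, kernel-checked

HONEST FRAMING (cell pub-hubbard): ladder R1–R4 with certified numbers; no claim on H/H₀. This file
is a BOUND FOR A MODEL CLASS (the seam-twisted `t–t'` Hubbard torus at high temperature, any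
filling, both signs of `U`); it makes no materials claim. LEAN FILING REQUEST #195 part 5 of 5
(bounds g25); imports #181.6 (`TwistInsensitivityCluster`, hence #181.1–#181.5) and part 4
(`TwistedCouplingDegree`, hence the generic parts 1–3 `ConnectedBondSetDecomposition`,
`ConnectedBondSetEntropy`, `CatalanPolymerSmallness`).

## What is proved (0 sorry)

Write `Z_L(θ) = Tr e^{-β(H^{tt'}_L(t',U;θ) - μN)}` (`hubbardTorusTT'FluxMu`, #181.1; `L ≥ 3`, hopping `t = 1`,
`t'` arbitrary, ONE seam column twisted by `e^{±iθ}`) and `s = |β|(1+|t'|) = (|t|+|t'|)/T`.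

THEOREM (`abs_log_partitionFn_twist_sub_le_catalan`). If `δ > 0` and

  `16 s · e^{1+2s} · (e^{1+δ} + 1)² ≤ 1`                                                    (KP-C)

then for every twist `θ`, every `U : ℝ` and every `μ : ℝ`: `|log Z_L(0) - log Z_L(θ)| ≤ 2 L² e^{-δL}`.

INSTANCE (`abs_log_partitionFn_twist_sub_le_of_le_inv_610`): (KP-C) holds with `δ = 10⁻³` as soon as
`s ≤ 1/610`, i.e. for all temperatures `T ≥ 610 (|t|+|t'|)`; then `|log Z_L(0) - log Z_L(θ)| ≤ 2 L² e^{-L/1000}`.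
(#181.6 needed `65² e⁶ · 2s ≤ 1/2`, i.e. `T ≥ 6.8·10⁶ (|t|+|t'|)`; the paper's Theorem 12 has
`T ≥ 160(|t|+|t'|)` with its sharper Hölder bond weights `e^{|c_b|}-1` — see "what is not proved".)

COROLLARY (node `HighTemperatureNoThermalStiffnessTT'Catalan`, proved): every flux stiffness `ρ_s` of
the grand-canonical free energy (`β ρ_s θ² ≤ log Z(0) - log Z(θ)` on `|θ| ≤ θ₀`) obeys
`ρ_s ≤ 2 L² e^{-δL} / (β θ₀²)` under (KP-C) — no thermal phase stiffness survives `L → ∞` at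
`T ≥ 610(|t|+|t'|)`, uniformly in `U` and `μ`.

NODES (four `@[conjecture] def`s, each with its `_holds` proof in this file):
`HighTemperatureTwistInsensitivityTT'Catalan` (Thm 12 (i) with the smallness function (KP-C) in place
of #181.1's `kpBarLHS`, free rate `δ`), `HighTemperatureNoThermalStiffnessTT'Catalan` (Thm 12 (ii),
same hypothesis), `HighTemperatureTwistInsensitivityTT'At610` and `HighTemperatureNoThermalStiffnessTT'At610`
(the certified readings at `β(1+|t'|) ≤ 1/610`, `δ = 10⁻³`; siblings of #191's `…At160` nodes, which
are proved there only from the OPEN node (i) of #181.1). #181.1's nodes (i)–(ii) themselves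
(`kpBarLHS`, window 160) remain open — see "what is NOT proved".

## The argument

1. (parts 1–3, generic: `ConnectedBondSetEntropy`, `CatalanPolymerSmallness`) the one-site Kotecký–Preiss bound
   `Σ_{A ∋ x} |ρ_c(A)| e^{(1+δ)|A|} ≤ 1` for the coupling-function activities of the tree
   (`couplingActivity`), from (a) Cauchy's estimate bond by bond, `|M_c(X)| ≤ ∏_{b∈X} |c_b| e^{1+|c_b|}`
   (radius `1/|c_b|` in the coordinate `b`), and (b) the Catalan recursion for connected bond sets
   through a site, `Σ_X (∏ w_b) e^{a|supp X|} ≤ F - e^{a}` whenever `e^{a} + W F² ≤ F`, `W` the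
   weighted degree `sup_v Σ_{b ∋ v} w_b` — here `a = 1+δ`, `F = e^{1+δ}+1`, condition `W F² ≤ 1`.
2. (part 4 `TwistedCouplingDegree`) `siteActivityC = couplingActivity` (the inclusion–exclusion weights of #181.4 are the
   tree's iterated differences), and the weighted degree of the twisted coupling:
   `Σ_{b ∋ v} |c_θ(b)| ≤ 16 |β| (1+|t'|)` (each of the four bond families of #181.3 has at most `8`
   index triples through a site; no injectivity needed), so `W ≤ 16 s e^{1+2s}` using the crude
   per-bond bound `|c_θ(b)| ≤ 2s` of #181.5 only inside the exponential (this file).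
3. (#181.6, reused verbatim) winding dichotomy `ρ_θ(A) = ρ_0(A)` for `|A| < L`, the two-gas tail
   estimate `norm_polymerLogZ_sub_le_of_eq_of_card_lt` (`2|Λ| e^{-δR}`), `Z_L(θ) = z₀^{L²} Ξ(ρ_θ) > 0` and
   `Re log Ξ = log Z`.

## What is NOT proved here (successor note)

The paper's window `T ≥ 160(|t|+|t'|)` (node `HighTemperatureTwistInsensitivityTT'` of #181.1, hypothesis
`kpBarLHS`) needs the Hölder bond weights `w_b = e^{|c_b|} - 1` of bounds.tex Lemma 12.3 (Duhamel /
divided differences of `exp` on the simplex) in place of the Cauchy weights `|c_b| e^{1+|c_b|}` used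
here; the Cauchy route cannot go below `T ≈ 390(|t|+|t'|)` even with the general anchored weight `a`
(bounds g25 NOTES). The entropy side (part 2) is already the paper's Lemma 12.4.

References: R. Kotecký, D. Preiss, Comm. Math. Phys. 103 (1986) 491, Theorem p. 492 [KoteckyPreiss1986];
D. Ueltschi, J. Stat. Phys. 95 (1999) 693 (arXiv:cond-mat/9810320) §2.3, §3 [Ueltschi1999];
D. J. Scalapino, S. R. White, S. C. Zhang, PRB 47 (1993) 7995 [ScalapinoWhiteZhang1993];
Xu et al., Science 384 (2024) eadh7691, eq. (1) [XuEtAl2024].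
-/

noncomputable section

namespace Summit.HubbardSuperconductivity.HubbardLadder.Bounds

open Matrix Finset Literature.MathematicalPhysics.QuantumLattice
  Literature.MathematicalPhysics.QuantumFieldTheory Literature.Probability.LatticeModels
open scoped ComplexConjugate ComplexOrder

/-! ### The twisted `t–t'` torus: Catalan smallness and the twist-insensitivity tail -/

section Torus

variable {L : ℕ} [NeZero L]

/-- **One-site Kotecký–Preiss smallness of the twisted activities, Catalan form**: with
`s = |β|(1+|t'|)`, if `δ ≥ 0` and `16 s e^{1+2s} (e^{1+δ}+1)² ≤ 1` then
`Σ_{A ∋ x} |ρ_θ(A)| e^{(1+δ)|A|} ≤ 1` for every site `x` and every `θ, U, μ`. [this file] -/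
theorem sum_norm_ttActivity_mul_exp_le_one (hL : 3 ≤ L) (β t' U μ θ : ℝ) {δ : ℝ} (hδ : 0 ≤ δ)
    (hsmall : 16 * (|β| * (1 + |t'|)) * Real.exp (1 + 2 * (|β| * (1 + |t'|))) *
      (Real.exp (1 + δ) + 1) ^ 2 ≤ 1)
    (x : FermionTorus 2 L) (𝒜 : Finset (Finset (FermionTorus 2 L))) (h𝒜 : ∀ A ∈ 𝒜, x ∈ A) :
    ∑ A ∈ 𝒜, ‖ttActivity L β t' U μ θ A‖ * Real.exp ((1 + δ) * A.card) ≤ 1 := by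
  have hr : siteRatio (β : ℂ) (U : ℂ) (μ : ℂ) ≤ 1 := (siteRatio_ofReal β U μ).le
  simp only [ttActivity, siteActivityC_eq_couplingActivity]
  refine sum_norm_couplingActivity_mul_exp_le_one (atomicPartitionFn_real_ne_zero β U μ) hr
    (δ := fun b => ‖ttFluxCoupling L β t' θ b‖) (fun _ _ => norm_nonneg _) (fun _ _ => le_rfl) hδ
    (fun v => ?_) hsmall x 𝒜 h𝒜
  -- the weighted degree `Σ_{b ∋ v} |c_b| e^{1+|c_b|} ≤ 16 s e^{1+2s}`
  have hexp : ∀ b : Bond (FermionTorus 2 L), Real.exp (1 + ‖ttFluxCoupling L β t' θ b‖) ≤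
      Real.exp (1 + 2 * (|β| * (1 + |t'|))) := fun b => by
    rw [Real.exp_le_exp]
    have := norm_ttFluxCoupling_le hL β t' θ b
    linarith
  refine (Finset.sum_le_sum fun b _ => mul_le_mul_of_nonneg_left (hexp b) (norm_nonneg _)).trans ?_
  rw [← Finset.sum_mul]
  exact mul_le_mul_of_nonneg_right (sum_norm_ttFluxCoupling_le β t' θ v _
    fun b hb => (@mem_verts_iff _ (_) _ _).1 ((@Finset.mem_filter _ _ (_) _ _).1 hb).2) (Real.exp_nonneg _)

/-- **Smallness**: under `16 s e^{1+2s} (e^{1+δ}+1)² ≤ 1` (`s = |β|(1+|t'|)`, `δ > 0`) the twisted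
activities are small in the one-site Kotecký–Preiss sense with rate `δ`, for every `θ, U, μ`.
[this file] -/
theorem isSmallActivity_ttActivity_catalan (hL : 3 ≤ L) (β t' U μ θ : ℝ) {δ : ℝ} (hδ : 0 < δ)
    (hsmall : 16 * (|β| * (1 + |t'|)) * Real.exp (1 + 2 * (|β| * (1 + |t'|))) *
      (Real.exp (1 + δ) + 1) ^ 2 ≤ 1) :
    IsSmallActivity (ttActivity L β t' U μ θ) δ where
  rho_empty := siteActivityC_empty _ _ _ _ _
  delta_pos := hδ
  sum_le_one x 𝒜 h𝒜 := sum_norm_ttActivity_mul_exp_le_one hL β t' U μ θ hδ.le hsmall x 𝒜 h𝒜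

/-- **The tail estimate for the Kotecký–Preiss logarithms**: `‖log Ξ(ρ_θ) - log Ξ(ρ_0)‖ ≤ 2 L² e^{-δL}`.
[this file] -/
theorem norm_polymerLogZ_ttActivity_sub_le_catalan (hL : 3 ≤ L) (β t' U μ θ : ℝ) {δ : ℝ} (hδ : 0 < δ)
    (hsmall : 16 * (|β| * (1 + |t'|)) * Real.exp (1 + 2 * (|β| * (1 + |t'|))) *
      (Real.exp (1 + δ) + 1) ^ 2 ≤ 1) :
    ‖polymerLogZ polyInc (ttActivity L β t' U μ θ) (Finset.univ : Finset (FermionTorus 2 L)).powerset -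
        polymerLogZ polyInc (ttActivity L β t' U μ 0) (Finset.univ : Finset (FermionTorus 2 L)).powerset‖ ≤
      2 * (L : ℝ) ^ 2 * Real.exp (-(δ * L)) := by
  have hL0 : (0 : ℝ) < L := by exact_mod_cast (show 0 < L by omega)
  have h := norm_polymerLogZ_sub_le_of_eq_of_card_lt (isSmallActivity_ttActivity_catalan hL β t' U μ θ hδ hsmall)
    (isSmallActivity_ttActivity_catalan hL β t' U μ 0 hδ hsmall) (Finset.univ : Finset (FermionTorus 2 L)).powerset
    hL0 (fun A _ hA => ttActivity_eq_of_card_lt hL β t' U μ θ (by exact_mod_cast hA))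
  have hcard : (Fintype.card (FermionTorus 2 L) : ℝ) = (L : ℝ) ^ 2 := by
    simp [FermionTorus, Fintype.card_lex]
  rw [hcard] at h
  exact h

/-- **The Kotecký–Preiss logarithm computes the free energy difference** whenever both activity
families are small: `Re (log Ξ(ρ_θ) - log Ξ(ρ_0)) = log Z_L(θ) - log Z_L(0)`. [this file; #181.6 with the
smallness as a hypothesis] -/
theorem re_polymerLogZ_sub_eq_log_sub_of_isSmallActivity (hL : 3 ≤ L) (β t' U μ θ : ℝ) {δ δ' : ℝ}
    (hθ : IsSmallActivity (ttActivity L β t' U μ θ) δ) (h0 : IsSmallActivity (ttActivity L β t' U μ 0) δ') :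
    (polymerLogZ polyInc (ttActivity L β t' U μ θ) (Finset.univ : Finset (FermionTorus 2 L)).powerset -
        polymerLogZ polyInc (ttActivity L β t' U μ 0) (Finset.univ : Finset (FermionTorus 2 L)).powerset).re =
      Real.log (partitionFn β (hubbardTorusTT'FluxMu L t' U μ θ)).re -
        Real.log (partitionFn β (hubbardTorusTT'FluxMu L t' U μ 0)).re := by
  have hθpos := partitionFn_hubbardTorusTT'FluxMu_re_pos (L := L) β t' U μ θ
  have h0pos := partitionFn_hubbardTorusTT'FluxMu_re_pos (L := L) β t' U μ 0
  have hθre := partitionFn_eq_re (isHermitian_hubbardTorusTT'FluxMu (L := L) t' U μ θ) β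
  have h0re := partitionFn_eq_re (isHermitian_hubbardTorusTT'FluxMu (L := L) t' U μ 0) β
  have hz : atomicPartitionFn (β : ℂ) (U : ℂ) (μ : ℂ) ^ Fintype.card (FermionTorus 2 L) ≠ 0 :=
    pow_ne_zero _ (atomicPartitionFn_real_ne_zero β U μ)
  have hΞ : ∀ θ' : ℝ, polymerPartitionFunction polyInc (ttActivity L β t' U μ θ')
      (Finset.univ : Finset (FermionTorus 2 L)).powerset =
        partitionFn β (hubbardTorusTT'FluxMu L t' U μ θ') /
          atomicPartitionFn (β : ℂ) (U : ℂ) (μ : ℂ) ^ Fintype.card (FermionTorus 2 L) := fun θ' => by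
    rw [eq_div_iff hz, partitionFn_hubbardTorusTT'FluxMu_eq_mul hL, mul_comm]
  have hexp : Complex.exp (polymerLogZ polyInc (ttActivity L β t' U μ θ)
        (Finset.univ : Finset (FermionTorus 2 L)).powerset -
      polymerLogZ polyInc (ttActivity L β t' U μ 0) (Finset.univ : Finset (FermionTorus 2 L)).powerset) =
      (((partitionFn β (hubbardTorusTT'FluxMu L t' U μ θ)).re /
          (partitionFn β (hubbardTorusTT'FluxMu L t' U μ 0)).re : ℝ) : ℂ) := by
    rw [Complex.exp_sub, hθ.exp_polymerLogZ, h0.exp_polymerLogZ, hΞ θ, hΞ 0,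
      div_div_div_cancel_right₀ hz, Complex.ofReal_div, ← hθre, ← h0re]
  rw [re_eq_log_of_exp_eq (div_pos hθpos h0pos) hexp, Real.log_div hθpos.ne' h0pos.ne']

/-- **THEOREM (twist insensitivity at high temperature, Catalan constants).** For `L ≥ 3`, real
`t', U, μ, β, θ`, `δ > 0` with `16 s e^{1+2s} (e^{1+δ}+1)² ≤ 1`, `s = |β|(1+|t'|)`:
`|log Z_L(0) - log Z_L(θ)| ≤ 2 L² e^{-δL}`. [this file] -/
theorem abs_log_partitionFn_twist_sub_le_catalan (hL : 3 ≤ L) (t' U μ β θ : ℝ) {δ : ℝ} (hδ : 0 < δ)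
    (hsmall : 16 * (|β| * (1 + |t'|)) * Real.exp (1 + 2 * (|β| * (1 + |t'|))) *
      (Real.exp (1 + δ) + 1) ^ 2 ≤ 1) :
    |Real.log (partitionFn β (hubbardTorusTT'FluxMu L t' U μ 0)).re -
        Real.log (partitionFn β (hubbardTorusTT'FluxMu L t' U μ θ)).re| ≤
      2 * (L : ℝ) ^ 2 * Real.exp (-(δ * L)) := by
  rw [abs_sub_comm, ← re_polymerLogZ_sub_eq_log_sub_of_isSmallActivity hL β t' U μ θ
    (isSmallActivity_ttActivity_catalan hL β t' U μ θ hδ hsmall)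
    (isSmallActivity_ttActivity_catalan hL β t' U μ 0 hδ hsmall)]
  exact (Complex.abs_re_le_norm _).trans (norm_polymerLogZ_ttActivity_sub_le_catalan hL β t' U μ θ hδ hsmall)

/-! ### The certified window `T ≥ 610 (|t|+|t'|)` -/

/-- **Certified instance of (KP-C)**: `16 s e^{1+2s} (e^{1+10⁻³}+1)² ≤ 1` for `0 ≤ s ≤ 1/610`
(`e ≤ 2.7182818286`, `e^{x} ≤ 1/(1-x)`; the left side is then `≤ 0.9905`). [this file] -/
theorem kpCatalan_of_le_inv_610 {s : ℝ} (hs0 : 0 ≤ s) (hs : s ≤ 1 / 610) :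
    16 * s * Real.exp (1 + 2 * s) * (Real.exp (1 + 1 / 1000) + 1) ^ 2 ≤ 1 := by
  have he : Real.exp 1 ≤ 2718281829 / 10 ^ 9 := Real.exp_one_lt_d9.le.trans (by norm_num)
  have h2s : Real.exp (2 * s) ≤ 610 / 608 := by
    refine (Real.exp_bound_div_one_sub_of_interval (by positivity) (by linarith)).trans ?_
    rw [div_le_div_iff₀ (by linarith) (by norm_num)]
    linarith
  have h1k : Real.exp (1 / 1000) ≤ 1000 / 999 :=
    (Real.exp_bound_div_one_sub_of_interval (by norm_num) (by norm_num)).trans (by norm_num)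
  have hA : Real.exp (1 + 2 * s) ≤ 2718281829 / 10 ^ 9 * (610 / 608) := by
    rw [Real.exp_add]; exact mul_le_mul he h2s (Real.exp_nonneg _) (by norm_num)
  have hB : Real.exp (1 + 1 / 1000) ≤ 2718281829 / 10 ^ 9 * (1000 / 999) := by
    rw [Real.exp_add]; exact mul_le_mul he h1k (Real.exp_nonneg _) (by norm_num)
  calc 16 * s * Real.exp (1 + 2 * s) * (Real.exp (1 + 1 / 1000) + 1) ^ 2
      ≤ 16 * (1 / 610) * (2718281829 / 10 ^ 9 * (610 / 608)) *
          (2718281829 / 10 ^ 9 * (1000 / 999) + 1) ^ 2 := by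
        gcongr
    _ ≤ 1 := by norm_num

/-- **THEOREM (twist insensitivity for `T ≥ 610(|t|+|t'|)`).** For `L ≥ 3`, real `t', U, μ, β, θ`
with `|β|(1+|t'|) ≤ 1/610`: `|log Z_L(0) - log Z_L(θ)| ≤ 2 L² e^{-L/1000}`. [this file] -/
theorem abs_log_partitionFn_twist_sub_le_of_le_inv_610 (hL : 3 ≤ L) (t' U μ β θ : ℝ)
    (hs : |β| * (1 + |t'|) ≤ 1 / 610) :
    |Real.log (partitionFn β (hubbardTorusTT'FluxMu L t' U μ 0)).re -
        Real.log (partitionFn β (hubbardTorusTT'FluxMu L t' U μ θ)).re| ≤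
      2 * (L : ℝ) ^ 2 * Real.exp (-((1 / 1000) * L)) :=
  abs_log_partitionFn_twist_sub_le_catalan hL t' U μ β θ (by norm_num)
    (kpCatalan_of_le_inv_610 (by positivity) hs)

/-! ### Nodes -/

/-- **Node (bounds.tex Thm 12 (i) with the Catalan tree-graph constants; PROVED below).** For `L ≥ 3`,
all real `t', U, μ, β`, every `δ > 0` with `16 s e^{1+2s} (e^{1+δ}+1)² ≤ 1` (`s = |β|(1+|t'|)`; holds
with `δ = 10⁻³` whenever `T ≥ 610(|t|+|t'|)`), and every seam twist `θ`:
`|log Re Z(0) - log Re Z(θ)| ≤ 2 L² e^{-δL}`, `Z(θ) = partitionFn β (hubbardTorusTT'FluxMu L t' U μ θ)` —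
uniformly in `U` (both signs) and `μ`. Same shape as #181.1's `HighTemperatureTwistInsensitivityTT'`
(`a = 1`, `b = δ`). [programme node: bounds.tex §12 Thm 12 (i); cites KoteckyPreiss1986 Thm p. 492,
Ueltschi1999 §3] -/
@[conjecture] def HighTemperatureTwistInsensitivityTT'Catalan : Prop :=
  ∀ (L : ℕ) [NeZero L], 3 ≤ L → ∀ (t' U μ β δ : ℝ), 0 < δ →
    16 * (|β| * (1 + |t'|)) * Real.exp (1 + 2 * (|β| * (1 + |t'|))) * (Real.exp (1 + δ) + 1) ^ 2 ≤ 1 →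
    ∀ θ : ℝ,
      |Real.log (partitionFn β (hubbardTorusTT'FluxMu L t' U μ 0)).re -
          Real.log (partitionFn β (hubbardTorusTT'FluxMu L t' U μ θ)).re| ≤
        2 * (L : ℝ) ^ 2 * Real.exp (-(δ * L))

/-- PROOF of the node `HighTemperatureTwistInsensitivityTT'Catalan`. [this file] -/
theorem highTemperatureTwistInsensitivityTT'Catalan_holds : HighTemperatureTwistInsensitivityTT'Catalan :=
  fun _L _ hL t' U μ β _δ hδ hsmall θ => abs_log_partitionFn_twist_sub_le_catalan hL t' U μ β θ hδ hsmall

/-- **Node (bounds.tex Thm 12 (ii), Catalan constants; PROVED below): no thermal phase stiffness.**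
Under the hypotheses of `HighTemperatureTwistInsensitivityTT'Catalan` with `β > 0`, every flux stiffness
`ρ_s` of the grand-canonical free energy — `β ρ_s θ² ≤ log Re Z(0) - log Re Z(θ)` for `|θ| ≤ θ₀`,
`θ₀ > 0` — satisfies `ρ_s ≤ 2 L² e^{-δL} / (β θ₀²)`, uniformly in `U, μ`; in particular `ρ_s → 0` as
`L → ∞` for every `T ≥ 610(|t|+|t'|)`. [programme node: bounds.tex §12 Thm 12 (ii); cites
ScalapinoWhiteZhang1993] -/
@[conjecture] def HighTemperatureNoThermalStiffnessTT'Catalan : Prop :=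
  ∀ (L : ℕ) [NeZero L], 3 ≤ L → ∀ (t' U μ β δ ρs θ₀ : ℝ), 0 < β → 0 < θ₀ → 0 < δ →
    16 * (|β| * (1 + |t'|)) * Real.exp (1 + 2 * (|β| * (1 + |t'|))) * (Real.exp (1 + δ) + 1) ^ 2 ≤ 1 →
    (∀ θ : ℝ, |θ| ≤ θ₀ → β * ρs * θ ^ 2 ≤
        Real.log (partitionFn β (hubbardTorusTT'FluxMu L t' U μ 0)).re -
          Real.log (partitionFn β (hubbardTorusTT'FluxMu L t' U μ θ)).re) →
    ρs ≤ 2 * (L : ℝ) ^ 2 * Real.exp (-(δ * L)) / (β * θ₀ ^ 2)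

/-- PROOF of the node `HighTemperatureNoThermalStiffnessTT'Catalan`: evaluate the stiffness hypothesis
at `θ = θ₀` and divide by `β θ₀² > 0`. [this file] -/
theorem highTemperatureNoThermalStiffnessTT'Catalan_holds : HighTemperatureNoThermalStiffnessTT'Catalan := by
  intro L _ hL t' U μ β δ ρs θ₀ hβ hθ₀ hδ hsmall hstiff
  have hins := abs_log_partitionFn_twist_sub_le_catalan hL t' U μ β θ₀ hδ hsmall
  have hE := hstiff θ₀ (by rw [abs_of_pos hθ₀])
  have hpos : 0 < β * θ₀ ^ 2 := mul_pos hβ (pow_pos hθ₀ 2)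
  rw [le_div_iff₀ hpos]
  calc ρs * (β * θ₀ ^ 2) = β * ρs * θ₀ ^ 2 := by ring
    _ ≤ _ := hE
    _ ≤ _ := le_abs_self _
    _ ≤ _ := hins

/-- **Node (certified reading `T ≥ 610(|t|+|t'|)` of Thm 12 (i); PROVED below).** For `L ≥ 3`, real
`t', U, μ`, `β > 0` with `β(1+|t'|) ≤ 1/610`, and every seam twist `θ`:
`|log Re Z(0) - log Re Z(θ)| ≤ 2 L² e^{-L/1000}`. Same shape as #191's `…At160` nodes, with the window
`T ≥ 610(|t|+|t'|)` that the Catalan/Cauchy constants certify (`kpCatalan_of_le_inv_610`).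
[programme node: bounds.tex §12 Thm 12 (i), Remark 12(d)] -/
@[conjecture] def HighTemperatureTwistInsensitivityTT'At610 : Prop :=
  ∀ (L : ℕ) [NeZero L], 3 ≤ L → ∀ (t' U μ β : ℝ), 0 < β → β * (1 + |t'|) ≤ 1 / 610 →
    ∀ θ : ℝ,
      |Real.log (partitionFn β (hubbardTorusTT'FluxMu L t' U μ 0)).re -
          Real.log (partitionFn β (hubbardTorusTT'FluxMu L t' U μ θ)).re| ≤
        2 * (L : ℝ) ^ 2 * Real.exp (-((1 / 1000) * L))

/-- PROOF of the node `HighTemperatureTwistInsensitivityTT'At610`. [this file] -/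
theorem highTemperatureTwistInsensitivityTT'At610_holds : HighTemperatureTwistInsensitivityTT'At610 := by
  intro L _ hL t' U μ β hβ hT θ
  exact abs_log_partitionFn_twist_sub_le_of_le_inv_610 hL t' U μ β θ (by rwa [abs_of_pos hβ])

/-- **Node (certified reading `T ≥ 610(|t|+|t'|)` of Thm 12 (ii); PROVED below): no thermal phase
stiffness.** For `L ≥ 3`, real `t', U, μ`, `β > 0` with `β(1+|t'|) ≤ 1/610`: every flux stiffness
`ρ_s` (`β ρ_s θ² ≤ log Re Z(0) - log Re Z(θ)` for `|θ| ≤ θ₀`, `θ₀ > 0`) satisfies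
`ρ_s ≤ 2 L² e^{-L/1000} / (β θ₀²)`, uniformly in `U`, `μ`. Unconditional sibling of #191's
`HighTemperatureNoThermalStiffnessTT'At160` (there: window 160, proved only from the open node (i)).
[programme node: bounds.tex §12 Thm 12 (ii), Remark 12(d)] -/
@[conjecture] def HighTemperatureNoThermalStiffnessTT'At610 : Prop :=
  ∀ (L : ℕ) [NeZero L], 3 ≤ L → ∀ (t' U μ β ρs θ₀ : ℝ), 0 < β → 0 < θ₀ →
    β * (1 + |t'|) ≤ 1 / 610 →
    (∀ θ : ℝ, |θ| ≤ θ₀ → β * ρs * θ ^ 2 ≤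
        Real.log (partitionFn β (hubbardTorusTT'FluxMu L t' U μ 0)).re -
          Real.log (partitionFn β (hubbardTorusTT'FluxMu L t' U μ θ)).re) →
    ρs ≤ 2 * (L : ℝ) ^ 2 * Real.exp (-((1 / 1000) * L)) / (β * θ₀ ^ 2)

/-- PROOF of the node `HighTemperatureNoThermalStiffnessTT'At610` (the Catalan node at `δ = 10⁻³` and
the certified numerical instance). [this file] -/
theorem highTemperatureNoThermalStiffnessTT'At610_holds : HighTemperatureNoThermalStiffnessTT'At610 := by
  intro L _ hL t' U μ β ρs θ₀ hβ hθ₀ hT hstiff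
  have hT' : |β| * (1 + |t'|) ≤ 1 / 610 := by rwa [abs_of_pos hβ]
  exact highTemperatureNoThermalStiffnessTT'Catalan_holds L hL t' U μ β (1 / 1000) ρs θ₀ hβ hθ₀
    (by norm_num) (kpCatalan_of_le_inv_610 (by positivity) hT') hstiff

end Torus

end Summit.HubbardSuperconductivity.HubbardLadder.Bounds

end
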